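import Summits.Ventures.PercRepro.C041AnchorGlue

/-!
# ROW C-041 — gluing two zones at their anchors: admissibility and «blue at `K`» (p6, gen 29; C-041.md §20 (b)(3))

Setting of `C041AnchorGlue`.  ADMISSIBILITY of the glued zone is `adm₂ ∧ adm₃ ∧ ¬ (inl a₂ ∈ D ∧ inl a₂ ∈ D2)`
(`adm_iff`: the merged anchor sub-zone must not collect a blue `1`-mark from one side and a blue `2`-mark from the
other), the red reach of the anchor is the union of the two (`inl_mem_K_iff`, `inr_mem_K_iff`), and «blue at `K`»
is `blueK₂ ∧ blueK₃` (`blueK_iff`).  The six counts multiply — `C041AnchorGlueSix`.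
-/

namespace PercRepro

namespace ZoneZ

namespace AnchorGlue

open ZoneData Pendant

universe u₁ u₂ u₃ u₄ u₅ u₆ u₇ u₈

variable {V₂ : Type u₁} {E₂ : Type u₂} {S₁ : Type u₃} {S₂ : Type u₄} {V₃ : Type u₅} {E₃ : Type u₆}
  {R₁ : Type u₇} {R₂ : Type u₈}
variable (Z₂ : ZoneData V₂ E₂ S₁ S₂) (a₂ : V₂) (Z₃ : ZoneData V₃ E₃ R₁ R₂) (a₃ : V₃)
  (σ : State (E₂ ⊕ E₃) (S₁ ⊕ R₁) (S₂ ⊕ R₂))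

/-! ## Admissibility and «blue at `K`» at the anchor -/

/-- **Admissibility of the glued zone**: both sides admissible, and the merged anchor sub-zone not deleted on both
sides. -/
theorem adm_iff :
    (glue Z₂ a₂ Z₃ a₃).adm σ ↔ Z₂.adm (restrL σ) ∧ Z₃.adm (restrR σ) ∧
      ¬ (Sum.inl a₂ ∈ (glue Z₂ a₂ Z₃ a₃).D σ ∧ Sum.inl a₂ ∈ (glue Z₂ a₂ Z₃ a₃).D2 σ) := by
  constructor
  · intro h
    refine ⟨?_, ?_, fun hh => (glue Z₂ a₂ Z₃ a₃).not_mem_D_of_mem_D2 (Sum.inl a₂) σ h hh.2 hh.1⟩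
    · rw [adm, Set.disjoint_left]
      intro x hxM hxD
      exact Set.disjoint_left.1 h ((inl_mem_M_iff Z₂ a₂ Z₃ a₃ σ x).2 (Or.inl hxM))
        ((inl_mem_D_iff Z₂ a₂ Z₃ a₃ σ x).2 (Or.inl hxD))
    · rw [adm, Set.disjoint_left]
      intro y hyM hyD
      by_cases hy : y = a₃
      · subst hy
        exact Set.disjoint_left.1 h ((inl_mem_M_iff Z₂ a₂ Z₃ y σ a₂).2 (Or.inr ⟨rfl, hyM⟩))
          ((inl_mem_D_iff Z₂ a₂ Z₃ y σ a₂).2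
            (Or.inr ⟨(inl_a_mem_D_iff Z₂ a₂ Z₃ y σ).2 (Or.inr hyD), mem_reach_of_mem rfl⟩))
      · exact Set.disjoint_left.1 h ((inr_mem_M_iff Z₂ a₂ Z₃ a₃ σ y).2 ⟨hy, hyM⟩)
          ((inr_mem_D_iff Z₂ a₂ Z₃ a₃ σ y).2 ⟨hy, Or.inl hyD⟩)
  · rintro ⟨h₂, h₃, hnot⟩
    rw [adm, Set.disjoint_left]
    intro w hwM hwD
    rcases w with x | y
    · rw [inl_mem_M_iff] at hwM
      rw [inl_mem_D_iff] at hwD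
      rcases hwM with hxM | ⟨rfl, hM⟩
      · rcases hwD with hxD | ⟨hj, hxP⟩
        · exact Set.disjoint_left.1 h₂ hxM hxD
        · refine hnot ⟨hj, (inl_a_mem_D2_iff Z₂ a₂ Z₃ a₃ σ).2 (Or.inl ?_)⟩
          exact (Z₂.mem_D2_iff_inter a₂ (restrL σ)).2 ⟨x, hxP, hxM⟩
      · refine hnot ⟨?_, (inl_a_mem_D2_iff Z₂ x Z₃ a₃ σ).2 (Or.inr (mem_reach_of_mem hM))⟩
        rcases hwD with hxD | ⟨hj, -⟩
        · exact (inl_a_mem_D_iff Z₂ x Z₃ a₃ σ).2 (Or.inl hxD)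
        · exact hj
    · rw [inr_mem_M_iff] at hwM
      rw [inr_mem_D_iff] at hwD
      obtain ⟨hy, hyM⟩ := hwM
      rcases hwD.2 with hyD | ⟨hj, hyP⟩
      · exact Set.disjoint_left.1 h₃ hyM hyD
      · refine hnot ⟨hj, (inl_a_mem_D2_iff Z₂ a₂ Z₃ a₃ σ).2 (Or.inr ?_)⟩
        exact (Z₃.mem_D2_iff_inter a₃ (restrR σ)).2 ⟨y, hyP, hyM⟩

/-- The junction condition for the source `{inl a₂}` holds. -/
theorem junction_singleton (c : Bool) : junction Z₂ a₂ Z₃ a₃ c (asPendant σ) {Sum.inl a₂} := by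
  unfold junction
  exact Or.inl (mem_reach_of_mem (by simp [leftSet]))

/-- A `Z₂`-vertex lies in the red reach of the anchor iff it does in `Z₂`. -/
theorem inl_mem_K_iff (x : V₂) :
    Sum.inl x ∈ (glue Z₂ a₂ Z₃ a₃).K {Sum.inl a₂} σ ↔ x ∈ Z₂.K {a₂} (restrL σ) := by
  unfold K RedAdj
  rw [adj_eq_cAdj, inl_mem_reach_iff Z₂ a₂ Z₃ a₃ true σ _ (by simp)]
  have e1 : leftSet ({Sum.inl a₂} : Set (V₂ ⊕ V₃)) = {a₂} := by
    ext v
    simp [leftSet]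
  rw [e1]
  constructor
  · rintro (h | ⟨-, h⟩)
    · exact h
    · exact h
  · intro h
    exact Or.inl h

/-- A `Z₃`-vertex lies in the red reach of the anchor iff it is not the stray vertex and does in `Z₃`. -/
theorem inr_mem_K_iff (y : V₃) :
    Sum.inr y ∈ (glue Z₂ a₂ Z₃ a₃).K {Sum.inl a₂} σ ↔ y ≠ a₃ ∧ y ∈ Z₃.K {a₃} (restrR σ) := by
  unfold K RedAdj
  rw [adj_eq_cAdj, inr_mem_reach_iff Z₂ a₂ Z₃ a₃ true σ _ (by simp)]
  have e2 : rightSet ({Sum.inl a₂} : Set (V₂ ⊕ V₃)) = ∅ := by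
    ext y
    simp [rightSet]
  rw [e2, reach_empty]
  simp only [Set.mem_empty_iff_false, false_or, junction_singleton, true_and]
  rfl

/-- **Blue at `K` of the glued zone**: both sides blue at their own `K`. -/
theorem blueK_iff :
    (glue Z₂ a₂ Z₃ a₃).blueK {Sum.inl a₂} σ ↔ Z₂.blueK {a₂} (restrL σ) ∧ Z₃.blueK {a₃} (restrR σ) := by
  unfold blueK
  rw [Set.disjoint_left]
  constructor
  · intro h
    constructor
    · rw [Set.disjoint_left]
      intro x hxK hxM
      refine h ((inl_mem_K_iff Z₂ a₂ Z₃ a₃ σ x).2 hxK) ?_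
      rcases hxM with hm | hm
      · exact Or.inl ((inl_mem_Blt_iff Z₂ a₂ Z₃ a₃ σ x).2 (Or.inl hm))
      · exact Or.inr ((inl_mem_Mt_iff Z₂ a₂ Z₃ a₃ σ x).2 (Or.inl hm))
    · rw [Set.disjoint_left]
      intro y hyK hyM
      by_cases hy : y = a₃
      · subst hy
        refine h ((inl_mem_K_iff Z₂ a₂ Z₃ y σ a₂).2 (mem_reach_of_mem rfl)) ?_
        rcases hyM with hm | hm
        · exact Or.inl ((inl_mem_Blt_iff Z₂ a₂ Z₃ y σ a₂).2 (Or.inr ⟨rfl, hm⟩))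
        · exact Or.inr ((inl_mem_Mt_iff Z₂ a₂ Z₃ y σ a₂).2 (Or.inr ⟨rfl, hm⟩))
      · refine h ((inr_mem_K_iff Z₂ a₂ Z₃ a₃ σ y).2 ⟨hy, hyK⟩) ?_
        rcases hyM with hm | hm
        · exact Or.inl ((inr_mem_Blt_iff Z₂ a₂ Z₃ a₃ σ y).2 ⟨hy, hm⟩)
        · exact Or.inr ((inr_mem_Mt_iff Z₂ a₂ Z₃ a₃ σ y).2 ⟨hy, hm⟩)
  · rintro ⟨h₂, h₃⟩ w hwK hwM
    rcases w with x | y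
    · have hxK := (inl_mem_K_iff Z₂ a₂ Z₃ a₃ σ x).1 hwK
      rcases hwM with hm | hm
      · rcases (inl_mem_Blt_iff Z₂ a₂ Z₃ a₃ σ x).1 hm with hm' | ⟨-, hm'⟩
        · exact Set.disjoint_left.1 h₂ hxK (Or.inl hm')
        · exact Set.disjoint_left.1 h₃ (mem_reach_of_mem rfl) (Or.inl hm')
      · rcases (inl_mem_Mt_iff Z₂ a₂ Z₃ a₃ σ x).1 hm with hm' | ⟨-, hm'⟩
        · exact Set.disjoint_left.1 h₂ hxK (Or.inr hm')
        · exact Set.disjoint_left.1 h₃ (mem_reach_of_mem rfl) (Or.inr hm')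
    · obtain ⟨hy, hyK⟩ := (inr_mem_K_iff Z₂ a₂ Z₃ a₃ σ y).1 hwK
      rcases hwM with hm | hm
      · exact Set.disjoint_left.1 h₃ hyK (Or.inl ((inr_mem_Blt_iff Z₂ a₂ Z₃ a₃ σ y).1 hm).2)
      · exact Set.disjoint_left.1 h₃ hyK (Or.inr ((inr_mem_Mt_iff Z₂ a₂ Z₃ a₃ σ y).1 hm).2)

end AnchorGlue

end ZoneZ

end PercRepro
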